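import Summits.AtomisticToContinuum.HydrodynamicLimit.Theorems.AntiMazurCoboundariesInfluenceLocalityObjects
import Summits.AtomisticToContinuum.HydrodynamicLimit.Theorems.BoltzmannGreenKubo.Negative.Stationarity
import Literature.MathematicalPhysics.KineticTheory.HardSphereCanonicalPairBound
import Literature.MathematicalPhysics.KineticTheory.HardSphereUniformGas
import HarnessLib

/-!
# Ruelle-type chain bounds under `G_N`, uniformly in `N`
# (prelim 1/2 of stub `stub_tightChainPressure`, line `true-anchored-infection`, crux `InfluenceLocality`,
# stmt-AtomisticToContinuum-13916; route AntiMazurCoboundaries)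

The SINGLE-TIME engine of the chain estimates of the line, closed now, uniformly in `N` at small reduced
density `σ` (`SmallDensity uniformProfile σ`, `HardSphereEulerRatio`):

* § 1 (product measure) `pi_chainEvent_eq`: for an injective label sequence `j : Fin (K+1) → Fin n` and
  measurable link sets `B m ⊆ 𝕋³`, the product Haar measure of the CHAIN EVENT
  `{x | ∀ m, x (j (m+1)) − x (j m) ∈ B m}` is `∏ m vol(B m)` (integrate the chain out from its end by
  translation invariance, `pi_inter_pairEvent_eq`);
* § 2 (canonical hard-sphere gas) `posGibbs_chainEvent_le`: under `posGibbsMeasure 1 ε_N (N+1)` the chain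
  event has probability `≤ 2^{K+1} ∏ m vol(B m)` for `K ≤ N` — drop the hard-core constraints involving the
  `K + 1` chain labels (`pi_hardCore_inter_chainEvent_le`) and pay the inverse insertion probability
  `Ξ_N(N−K)/Ξ_N(N+1) = r_N(N+1, K+1) ≤ 2^{K+1}` (`hcProb_sdiff_image_div_eq`, `SmallDensity.rN_le_two_pow`):
  the `(K+1)`-point case of Ruelle's bound `ρ_m ≤ ξ^m` (Ruelle 1969 §4.2); `K = 1` is the tree's
  `posGibbs_pairEvent_le`;
* § 3 (the crux's law `G_N = gibbs σ a θ u₀ N Φ`) `gibbs_chainEvent_le` (time `0`: the position marginal of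
  `G_N` is the canonical configurational measure and the constant activity cancels), `gibbs_preimage_flow`
  (stationarity, `measurePreserving_flow_localGibbsLaw`) and `gibbs_chainEventAt_le` /
  `gibbs_chainEventAt_bound` (any fixed time `t`).

Prelim 2/2 (`…TightChainPressureNecklace`) turns this into the static-necklace tail.
-/

namespace Summit.AtomisticToContinuum.HydrodynamicLimit.Theorems.TrueAnchoredInfection

open MeasureTheory ProbabilityTheory Finset Set
open scoped Classical ENNReal
open Literature.Analysis.FluidPDE Literature.MathematicalPhysics.KineticTheory
open Literature.MathematicalPhysics.StatisticalMechanics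

noncomputable section

/-! ## § 1 Chain events under the product Haar measure -/

/-- The chain event is measurable. -/
theorem measurableSet_chainEvent {n K : ℕ} (j : Fin (K + 1) → Fin n) {B : Fin K → Set T3}
    (hB : ∀ m, MeasurableSet (B m)) :
    MeasurableSet {x : Fin n → T3 | ∀ m : Fin K, x (j m.succ) - x (j m.castSucc) ∈ B m} := by
  have h : {x : Fin n → T3 | ∀ m : Fin K, x (j m.succ) - x (j m.castSucc) ∈ B m}
      = ⋂ m : Fin K, {x : Fin n → T3 | x (j m.succ) - x (j m.castSucc) ∈ B m} := by
    ext x; simp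
  rw [h]
  exact MeasurableSet.iInter fun m => measurableSet_pairEvent _ _ (hB m)

/-- Integrating out one coordinate on which `S` does not depend: for `a ≠ b` and measurable `S`, `T`,
`ℙ^{⊗}(S ∩ {x_a − x_b ∈ T}) = ℙ^{⊗}(S) · vol(T)` (translation invariance of Haar measure). -/
theorem pi_inter_pairEvent_eq {n : ℕ} {S : Set (Fin n → T3)} (hS : MeasurableSet S) {a b : Fin n}
    (hab : a ≠ b) (hSa : ∀ x y, Function.update x a y ∈ S ↔ x ∈ S) {T : Set T3}
    (hT : MeasurableSet T) :
    (Measure.pi fun _ : Fin n => (volume : Measure T3)) (S ∩ {x | x a - x b ∈ T}) =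
      (Measure.pi fun _ : Fin n => (volume : Measure T3)) S * volume T := by
  have hE := measurableSet_pairEvent (n := n) a b hT
  rw [← lintegral_indicator_one (hS.inter hE),
    lintegral_pi_eq_lintegral_update (volume : Measure T3) a (measurable_one.indicator (hS.inter hE))]
  have hinner : ∀ x : Fin n → T3,
      ∫⁻ y, (S ∩ {x : Fin n → T3 | x a - x b ∈ T}).indicator 1 (Function.update x a y)
        ∂(volume : Measure T3) = S.indicator 1 x * volume T := by
    intro x
    by_cases hx : x ∈ S
    · have hset : (fun y : T3 => (S ∩ {x : Fin n → T3 | x a - x b ∈ T}).indicator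
          (1 : (Fin n → T3) → ℝ≥0∞) (Function.update x a y)) =
          ((fun y : T3 => y - x b) ⁻¹' T).indicator 1 := by
        funext y
        have hy : Function.update x a y ∈ S := (hSa x y).2 hx
        simp only [Set.indicator, Set.mem_inter_iff, hy, true_and, Set.mem_setOf_eq,
          Set.mem_preimage, Function.update_self, Function.update_of_ne hab.symm, Pi.one_apply]
      rw [hset, lintegral_indicator_one (measurable_sub_const _ hT), Set.indicator_of_mem hx,
        Pi.one_apply, one_mul]
      have hfun : (fun y : T3 => y - x b) = fun y => y + -x b := by
        funext y; rw [sub_eq_add_neg]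
      rw [hfun]
      exact measure_preimage_add_right _ _ _
    · have hset : (fun y : T3 => (S ∩ {x : Fin n → T3 | x a - x b ∈ T}).indicator
          (1 : (Fin n → T3) → ℝ≥0∞) (Function.update x a y)) = fun _ => 0 := by
        funext y
        exact Set.indicator_of_notMem (fun h => hx ((hSa x y).1 h.1)) _
      rw [hset, Set.indicator_of_notMem hx, zero_mul, lintegral_zero]
  simp_rw [hinner]
  rw [lintegral_mul_const _ (measurable_one.indicator hS), lintegral_indicator_one hS]

/-- **The product measure of a chain event is the product of the link volumes**: for an injective
label sequence `j` and measurable link sets,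
`ℙ^{⊗}{∀ m, x_{j(m+1)} − x_{j m} ∈ B_m} = ∏_m vol(B_m)` (integrate out `x_{j K}`, then
`x_{j(K-1)}`, …, by translation invariance). -/
theorem pi_chainEvent_eq {n : ℕ} : ∀ {K : ℕ} {j : Fin (K + 1) → Fin n} (_ : Function.Injective j)
    {B : Fin K → Set T3} (_ : ∀ m, MeasurableSet (B m)),
    (Measure.pi fun _ : Fin n => (volume : Measure T3))
      {x : Fin n → T3 | ∀ m : Fin K, x (j m.succ) - x (j m.castSucc) ∈ B m} = ∏ m, volume (B m)
  | 0, j, _, B, _ => by simp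
  | K + 1, j, hj, B, hB => by
      have hsplit : {x : Fin n → T3 | ∀ m : Fin (K + 1), x (j m.succ) - x (j m.castSucc) ∈ B m}
          = {x : Fin n → T3 | ∀ m : Fin K, x ((j ∘ Fin.castSucc) m.succ) - x ((j ∘ Fin.castSucc) m.castSucc) ∈ (B ∘ Fin.castSucc) m} ∩
          {x | x (j (Fin.last (K + 1))) - x (j (Fin.last K).castSucc) ∈ B (Fin.last K)} := by
        ext x
        simp only [Set.mem_setOf_eq, Set.mem_inter_iff, Function.comp_apply]
        constructor
        · intro h
          refine ⟨fun m => ?_, ?_⟩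
          · have := h m.castSucc
            rwa [Fin.succ_castSucc] at this
          · have := h (Fin.last K)
            rwa [Fin.succ_last] at this
        · rintro ⟨h1, h2⟩ m
          induction m using Fin.lastCases with
          | last => rwa [Fin.succ_last]
          | cast m => rw [Fin.succ_castSucc]; exact h1 m
      have hab : j (Fin.last (K + 1)) ≠ j (Fin.last K).castSucc := fun h =>
        (Fin.castSucc_lt_last (Fin.last K)).ne' (hj h)
      have hSa : ∀ (x : Fin n → T3) (y : T3),
          Function.update x (j (Fin.last (K + 1))) y ∈
              {x : Fin n → T3 | ∀ m : Fin K, x ((j ∘ Fin.castSucc) m.succ) - x ((j ∘ Fin.castSucc) m.castSucc) ∈ (B ∘ Fin.castSucc) m}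
            ↔ x ∈ {x : Fin n → T3 | ∀ m : Fin K, x ((j ∘ Fin.castSucc) m.succ) - x ((j ∘ Fin.castSucc) m.castSucc) ∈ (B ∘ Fin.castSucc) m} := by
        intro x y
        have hne : ∀ m : Fin (K + 1), j m.castSucc ≠ j (Fin.last (K + 1)) := fun m h =>
          (Fin.castSucc_lt_last m).ne (hj h)
        simp only [Set.mem_setOf_eq, Function.comp_apply, Function.update_of_ne (hne _)]
      rw [hsplit, pi_inter_pairEvent_eq (measurableSet_chainEvent (j ∘ Fin.castSucc)
          (B := B ∘ Fin.castSucc) fun m => hB _) hab hSa (hB _),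
        pi_chainEvent_eq (B := B ∘ Fin.castSucc) (hj.comp (Fin.castSucc_injective _)) (fun m => hB _),
        Fin.prod_univ_castSucc]
      rfl


/-- Membership in a chain event only depends on the coordinates labelled by the range of `j`. -/
theorem mem_chainEvent_iff_of_eqOn {n K : ℕ} (j : Fin (K + 1) → Fin n) (B : Fin K → Set T3)
    {x y : Fin n → T3} (hxy : ∀ i ∈ ((univ : Finset (Fin (K + 1))).image j : Finset (Fin n)), x i = y i) :
    x ∈ {x : Fin n → T3 | ∀ m : Fin K, x (j m.succ) - x (j m.castSucc) ∈ B m}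
      ↔ y ∈ {x : Fin n → T3 | ∀ m : Fin K, x (j m.succ) - x (j m.castSucc) ∈ B m} := by
  have h : ∀ m : Fin (K + 1), x (j m) = y (j m) := fun m =>
    hxy (j m) (mem_image_of_mem j (mem_univ m))
  simp only [Set.mem_setOf_eq, h]

/-! ## § 2 The canonical hard-sphere gas -/

/-- **Dropping the hard-core constraints of the chain labels and integrating the chain out**: for an
injective label sequence `j` (range `J`) and measurable link sets,
`ℙ^{⊗}(hardCore(univ) ∩ chainEvent) ≤ Ξ(univ ∖ J) · ∏_m vol(B_m)`. -/
theorem pi_hardCore_inter_chainEvent_le (ε : ℝ) {n K : ℕ} {j : Fin (K + 1) → Fin n}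
    (hj : Function.Injective j) {B : Fin K → Set T3} (hB : ∀ m, MeasurableSet (B m)) :
    (Measure.pi fun _ : Fin n => (volume : Measure T3))
        (hardCoreSet (Ov ε) (univ : Finset (Fin n)) ∩
          {x : Fin n → T3 | ∀ m : Fin K, x (j m.succ) - x (j m.castSucc) ∈ B m})
      ≤ ENNReal.ofReal (hcProb (Ov ε) (volume : Measure T3)
          ((univ : Finset (Fin n)) \ (univ : Finset (Fin (K + 1))).image j)) * ∏ m, volume (B m) := by
  set J : Finset (Fin n) := (univ : Finset (Fin (K + 1))).image j with hJ
  set W : Finset (Fin n) := (univ : Finset (Fin n)) \ J with hW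
  set P : Measure (Fin n → T3) := Measure.pi fun _ : Fin n => (volume : Measure T3) with hP
  have hHC : MeasurableSet (hardCoreSet (Ov ε) W : Set (Fin n → T3)) :=
    measurableSet_hardCoreSet (measurableSet_ov ε) W
  have hE : MeasurableSet ({x : Fin n → T3 | ∀ m : Fin K, x (j m.succ) - x (j m.castSucc) ∈ B m}) := measurableSet_chainEvent j hB
  -- monotonicity of the hard core in the label set
  have hsub : hardCoreSet (Ov ε) (univ : Finset (Fin n)) ∩ {x : Fin n → T3 | ∀ m : Fin K, x (j m.succ) - x (j m.castSucc) ∈ B m}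
      ⊆ hardCoreSet (Ov ε) W ∩ {x : Fin n → T3 | ∀ m : Fin K, x (j m.succ) - x (j m.castSucc) ∈ B m} :=
    Set.inter_subset_inter_left _ fun x hx a _ b _ hab => hx a (mem_univ a) b (mem_univ b) hab
  refine (measure_mono hsub).trans ?_
  -- factorisation: the two indicators depend on disjoint label sets
  have hdisj : Disjoint W J := sdiff_disjoint
  have hF : DependsOn (fun x : Fin n → T3 =>
      (hardCoreSet (Ov ε) W : Set (Fin n → T3)).indicator (1 : (Fin n → T3) → ℝ) x) (W : Set (Fin n)) := by
    intro x y hxy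
    change (hardCoreSet (Ov ε) W : Set (Fin n → T3)).indicator (1 : (Fin n → T3) → ℝ) x
      = (hardCoreSet (Ov ε) W : Set (Fin n → T3)).indicator (1 : (Fin n → T3) → ℝ) y
    have hiff : x ∈ hardCoreSet (Ov ε) W ↔ y ∈ hardCoreSet (Ov ε) W := by
      simp only [hardCoreSet, Set.mem_setOf_eq]
      constructor
      · intro h a ha b hb hab; rw [← hxy a ha, ← hxy b hb]; exact h a ha b hb hab
      · intro h a ha b hb hab; rw [hxy a ha, hxy b hb]; exact h a ha b hb hab
    by_cases hx : x ∈ hardCoreSet (Ov ε) W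
    · rw [Set.indicator_of_mem hx, Set.indicator_of_mem (hiff.1 hx)]; rfl
    · rw [Set.indicator_of_notMem hx, Set.indicator_of_notMem (fun hy => hx (hiff.2 hy))]
  have hG : DependsOn (fun x : Fin n → T3 => ({x : Fin n → T3 | ∀ m : Fin K, x (j m.succ) - x (j m.castSucc) ∈ B m}).indicator (1 : (Fin n → T3) → ℝ) x)
      (J : Set (Fin n)) := by
    intro x y hxy
    change ({x : Fin n → T3 | ∀ m : Fin K, x (j m.succ) - x (j m.castSucc) ∈ B m}).indicator (1 : (Fin n → T3) → ℝ) x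
      = ({x : Fin n → T3 | ∀ m : Fin K, x (j m.succ) - x (j m.castSucc) ∈ B m}).indicator (1 : (Fin n → T3) → ℝ) y
    have hiff : x ∈ {x : Fin n → T3 | ∀ m : Fin K, x (j m.succ) - x (j m.castSucc) ∈ B m} ↔ y ∈ {x : Fin n → T3 | ∀ m : Fin K, x (j m.succ) - x (j m.castSucc) ∈ B m} :=
      mem_chainEvent_iff_of_eqOn j B fun i hi => hxy i hi
    by_cases hx : x ∈ {x : Fin n → T3 | ∀ m : Fin K, x (j m.succ) - x (j m.castSucc) ∈ B m}
    · rw [Set.indicator_of_mem hx, Set.indicator_of_mem (hiff.1 hx)]; rfl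
    · rw [Set.indicator_of_notMem hx, Set.indicator_of_notMem (fun hy => hx (hiff.2 hy))]
  have hFm : Measurable fun x : Fin n → T3 =>
      (hardCoreSet (Ov ε) W : Set (Fin n → T3)).indicator (1 : (Fin n → T3) → ℝ) x :=
    measurable_one.indicator hHC
  have hGm : Measurable fun x : Fin n → T3 => ({x : Fin n → T3 | ∀ m : Fin K, x (j m.succ) - x (j m.castSucc) ∈ B m}).indicator (1 : (Fin n → T3) → ℝ) x :=
    measurable_one.indicator hE
  have hprod := integral_mul_eq_of_dependsOn (volume : Measure T3) hdisj hFm hGm hF hG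
  have hinter : (hardCoreSet (Ov ε) W ∩ {x : Fin n → T3 | ∀ m : Fin K, x (j m.succ) - x (j m.castSucc) ∈ B m}).indicator (1 : (Fin n → T3) → ℝ)
      = fun x => (hardCoreSet (Ov ε) W : Set (Fin n → T3)).indicator 1 x * ({x : Fin n → T3 | ∀ m : Fin K, x (j m.succ) - x (j m.castSucc) ∈ B m}).indicator 1 x := by
    rw [Set.inter_indicator_one]
    rfl
  have h1 : P.real (hardCoreSet (Ov ε) W ∩ {x : Fin n → T3 | ∀ m : Fin K, x (j m.succ) - x (j m.castSucc) ∈ B m})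
      = hcProb (Ov ε) (volume : Measure T3) W * P.real ({x : Fin n → T3 | ∀ m : Fin K, x (j m.succ) - x (j m.castSucc) ∈ B m}) := by
    rw [← integral_indicator_one (hHC.inter hE), hinter, hP, hprod, integral_indicator_one hHC,
      integral_indicator_one hE, hcProb]
  haveI : IsFiniteMeasure P := by rw [hP]; infer_instance
  have hfin : P (hardCoreSet (Ov ε) W ∩ {x : Fin n → T3 | ∀ m : Fin K, x (j m.succ) - x (j m.castSucc) ∈ B m}) ≠ ∞ := measure_ne_top _ _
  rw [← ENNReal.ofReal_toReal hfin, ← measureReal_def, h1,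
    ENNReal.ofReal_mul (hcProb_nonneg (volume : Measure T3) W), measureReal_def,
    ENNReal.ofReal_toReal (measure_ne_top _ _), hP, pi_chainEvent_eq hj hB]

/-- **The canonical chain law is dominated by `Ξ(univ ∖ J)/Ξ(univ)` times the product of Haar
measures**: `posGibbsMeasure 1 ε n (chainEvent j B) ≤ (Ξ(univ ∖ J) · Ξ(univ)⁻¹) · ∏_m vol(B_m)`. -/
theorem posGibbs_chainEvent_le_ratio (ε : ℝ) {n K : ℕ} {j : Fin (K + 1) → Fin n}
    (hj : Function.Injective j) {B : Fin K → Set T3} (hB : ∀ m, MeasurableSet (B m)) :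
    posGibbsMeasure (fun _ => (1 : ℝ)) ε n
        {x : Fin n → T3 | ∀ m : Fin K, x (j m.succ) - x (j m.castSucc) ∈ B m}
      ≤ ENNReal.ofReal (hcProb (Ov ε) (volume : Measure T3)
            ((univ : Finset (Fin n)) \ (univ : Finset (Fin (K + 1))).image j) *
          (hcProb (Ov ε) (volume : Measure T3) (univ : Finset (Fin n)))⁻¹) * ∏ m, volume (B m) := by
  have hE := measurableSet_chainEvent j hB
  rw [posGibbsMeasure_eq continuous_const (fun _ => one_pos) ε n, Measure.smul_apply, smul_eq_mul,
    Measure.restrict_apply hE, profileOf_one_μ, Xi, firstLabels_self, profileOf_one_μ, Set.inter_comm]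
  calc ENNReal.ofReal (hcProb (Ov ε) (volume : Measure T3) (univ : Finset (Fin n)))⁻¹ *
        (Measure.pi fun _ : Fin n => (volume : Measure T3))
          (hardCoreSet (Ov ε) (univ : Finset (Fin n)) ∩
            {x : Fin n → T3 | ∀ m : Fin K, x (j m.succ) - x (j m.castSucc) ∈ B m})
      ≤ ENNReal.ofReal (hcProb (Ov ε) (volume : Measure T3) (univ : Finset (Fin n)))⁻¹ *
          (ENNReal.ofReal (hcProb (Ov ε) (volume : Measure T3)
            ((univ : Finset (Fin n)) \ (univ : Finset (Fin (K + 1))).image j)) * ∏ m, volume (B m)) :=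
        mul_le_mul' le_rfl (pi_hardCore_inter_chainEvent_le ε hj hB)
    _ = _ := by
        rw [ENNReal.ofReal_mul (hcProb_nonneg _ _), ← mul_assoc, mul_comm (ENNReal.ofReal _⁻¹)]

/-- The ratio of hard-core probabilities along the hydrodynamic scaling is an inverse insertion
probability of `K + 1` particles: `Ξ_N(univ ∖ J) / Ξ_N(univ) = r_N(N + 1, K + 1)` for a range `J` of
`K + 1 ≤ N + 1` distinct labels. -/
theorem hcProb_sdiff_image_div_eq (σ : ℝ) {N K : ℕ} {j : Fin (K + 1) → Fin (N + 1)}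
    (hj : Function.Injective j) :
    hcProb (Ov (hsDiameter σ N)) (volume : Measure T3)
          ((univ : Finset (Fin (N + 1))) \ (univ : Finset (Fin (K + 1))).image j) *
        (hcProb (Ov (hsDiameter σ N)) (volume : Measure T3) (univ : Finset (Fin (N + 1))))⁻¹
      = rN uniformProfile σ N (N + 1) (K + 1) := by
  have hKN : K + 1 ≤ N + 1 := by
    have h := Finset.card_le_univ ((univ : Finset (Fin (K + 1))).image j)
    rwa [card_image_of_injective _ hj, card_univ, Fintype.card_fin, Fintype.card_fin] at h
  have hcard : ((univ : Finset (Fin (N + 1))) \ (univ : Finset (Fin (K + 1))).image j).card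
      = (firstLabels (N + 1) (N - K)).card := by
    rw [card_sdiff, Finset.inter_univ, card_univ, Fintype.card_fin, card_image_of_injective _ hj,
      card_univ, Fintype.card_fin, card_firstLabels (by omega)]
    omega
  have h1 : hcProb (Ov (hsDiameter σ N)) (volume : Measure T3)
      ((univ : Finset (Fin (N + 1))) \ (univ : Finset (Fin (K + 1))).image j)
      = XiN uniformProfile σ N (N - K) := by
    rw [XiN, Xi, uniformProfile_μ]
    exact hcProb_eq_of_card_eq (volume : Measure T3) (measurableSet_ov _) hcard
  have h2 : hcProb (Ov (hsDiameter σ N)) (volume : Measure T3) (univ : Finset (Fin (N + 1)))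
      = XiN uniformProfile σ N (N + 1) := by
    rw [XiN, Xi, uniformProfile_μ, firstLabels_self]
  rw [h1, h2, rN, show N + 1 - (K + 1) = N - K by omega, div_eq_mul_inv]

/-- **Ruelle-type bound for the canonical chain law at small density.** Under
`SmallDensity uniformProfile σ`, for `K ≤ N`, an injective label sequence `j : Fin (K+1) → Fin (N+1)` and
measurable link sets `B m ⊆ 𝕋³`:
`posGibbsMeasure 1 (hsDiameter σ N) (N+1) {∀ m, x_{j(m+1)} − x_{j m} ∈ B m} ≤ 2^{K+1} ∏_m vol(B m)` —
uniformly in `N`; the case `K = 1` is `posGibbs_pairEvent_le`. -/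
theorem posGibbs_chainEvent_le {σ : ℝ} (h : SmallDensity uniformProfile σ) {N K : ℕ} (hK : K ≤ N)
    {j : Fin (K + 1) → Fin (N + 1)} (hj : Function.Injective j) {B : Fin K → Set T3}
    (hB : ∀ m, MeasurableSet (B m)) :
    posGibbsMeasure (fun _ => (1 : ℝ)) (hsDiameter σ N) (N + 1)
        {x : Fin (N + 1) → T3 | ∀ m : Fin K, x (j m.succ) - x (j m.castSucc) ∈ B m}
      ≤ 2 ^ (K + 1) * ∏ m, volume (B m) := by
  refine (posGibbs_chainEvent_le_ratio (hsDiameter σ N) hj hB).trans ?_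
  rw [hcProb_sdiff_image_div_eq σ hj]
  refine mul_le_mul' ?_ le_rfl
  have hr : rN uniformProfile σ N (N + 1) (K + 1) ≤ 2 ^ (K + 1) := h.rN_le_two_pow le_rfl (by omega)
  calc ENNReal.ofReal (rN uniformProfile σ N (N + 1) (K + 1))
      ≤ ENNReal.ofReal ((2 : ℝ) ^ (K + 1)) := ENNReal.ofReal_le_ofReal hr
    _ = 2 ^ (K + 1) := by
        rw [ENNReal.ofReal_pow (by norm_num : (0 : ℝ) ≤ 2), ENNReal.ofReal_ofNat]


/-! ## § 3 Under the global Gibbs law `G_N` of the crux, at any time -/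

/-- The time-`0` chain event of phase space (positions only) is measurable. -/
theorem measurableSet_posChainEvent {N K : ℕ} (j : Fin (K + 1) → Fin (N + 1)) {B : Fin K → Set T3}
    (hB : ∀ m, MeasurableSet (B m)) :
    MeasurableSet {z : Phase N | ∀ m : Fin K, (z (j m.succ)).1 - (z (j m.castSucc)).1 ∈ B m} := by
  have hposm : Measurable (fun (z : Phase N) (i : Fin (N + 1)) => (z i).1) :=
    measurable_pi_lambda _ fun i => (measurable_pi_apply i).fst
  exact hposm (measurableSet_chainEvent j hB)

/-- **Chain bound under `G_N` at time `0`**: for `SmallDensity uniformProfile σ`, `a, θ > 0`, `K ≤ N`,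
an injective label sequence and measurable link sets,
`G_N{∀ m, x_{j(m+1)} − x_{j m} ∈ B m} ≤ 2^{K+1} ∏_m vol(B m)` (the position marginal of `G_N` is the
canonical configurational measure `localGibbsMeasure_preimage_pos`, whose constant activity cancels). -/
theorem gibbs_chainEvent_le {σ a θ : ℝ} (u₀ : V3) (h : SmallDensity uniformProfile σ)
    (ha : 0 < a) (hθ : 0 < θ) {N K : ℕ} (hK : K ≤ N) (Φ : Flow σ N)
    {j : Fin (K + 1) → Fin (N + 1)} (hj : Function.Injective j) {B : Fin K → Set T3}
    (hB : ∀ m, MeasurableSet (B m)) :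
    gibbs σ a θ u₀ N Φ {z : Phase N | ∀ m : Fin K, (z (j m.succ)).1 - (z (j m.castSucc)).1 ∈ B m}
      ≤ 2 ^ (K + 1) * ∏ m, volume (B m) := by
  have hE := measurableSet_chainEvent j hB
  have hset : {z : Phase N | ∀ m : Fin K, (z (j m.succ)).1 - (z (j m.castSucc)).1 ∈ B m}
      = (fun (z : Phase N) (i : Fin (N + 1)) => (z i).1) ⁻¹'
        {x : Fin (N + 1) → T3 | ∀ m : Fin K, x (j m.succ) - x (j m.castSucc) ∈ B m} := rfl
  -- the constant activity `a` cancels (`posGibbsMeasure_const_eq_one` of `CollisionFluxUpperBound`)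
  have hconst : posGibbsMeasure (fun _ : T3 => a) (hsDiameter σ N) (N + 1)
      = posGibbsMeasure (fun _ : T3 => (1 : ℝ)) (hsDiameter σ N) (N + 1) := by
    rw [posGibbsMeasure_eq continuous_const (fun _ => ha), posGibbsMeasure_eq continuous_const
      (fun _ => one_pos), profileOf_const ha, profileOf_const one_pos]
  rw [gibbs, hset, localGibbsLaw_eq, localGibbsMeasure_preimage_pos continuous_const continuous_const
      continuous_const (fun _ => ha.le) (fun _ => hθ) σ N hE, hconst]
  exact posGibbs_chainEvent_le h hK hj hB

/-- **Stationarity of `G_N`**: events transported by `Φ_t` have the same `G_N`-probability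
(`measurePreserving_flow_localGibbsLaw`). -/
theorem gibbs_preimage_flow {σ : ℝ} (a θ : ℝ) (u₀ : V3) {N : ℕ} (Φ : Flow σ N) (t : ℝ)
    {E : Set (Phase N)} (hE : MeasurableSet E) :
    gibbs σ a θ u₀ N Φ (Φ.flow t ⁻¹' E) = gibbs σ a θ u₀ N Φ E :=
  (BoltzmannGreenKuboOrthMomentum.measurePreserving_flow_localGibbsLaw a θ u₀ Φ t).measure_preimage
    hE.nullMeasurableSet

/-- **Chain bound under `G_N` at a fixed time `t`** (stationarity moves the configuration to time `0`):
`G_N{∀ m, x_{j(m+1)}(t) − x_{j m}(t) ∈ B m} ≤ 2^{K+1} ∏_m vol(B m)`, uniformly in `N ≥ K`, `t`, `Φ`. -/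
theorem gibbs_chainEventAt_le {σ a θ : ℝ} (u₀ : V3) (h : SmallDensity uniformProfile σ)
    (ha : 0 < a) (hθ : 0 < θ) {N K : ℕ} (hK : K ≤ N) (Φ : Flow σ N) (t : ℝ)
    {j : Fin (K + 1) → Fin (N + 1)} (hj : Function.Injective j) {B : Fin K → Set T3}
    (hB : ∀ m, MeasurableSet (B m)) :
    gibbs σ a θ u₀ N Φ
        {z : Phase N | ∀ m : Fin K, (Φ.flow t z (j m.succ)).1 - (Φ.flow t z (j m.castSucc)).1 ∈ B m}
      ≤ 2 ^ (K + 1) * ∏ m, volume (B m) := by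
  have hset : {z : Phase N | ∀ m : Fin K, (Φ.flow t z (j m.succ)).1 - (Φ.flow t z (j m.castSucc)).1 ∈ B m}
      = Φ.flow t ⁻¹' {z : Phase N | ∀ m : Fin K, (z (j m.succ)).1 - (z (j m.castSucc)).1 ∈ B m} := rfl
  rw [hset, gibbs_preimage_flow a θ u₀ Φ t (measurableSet_posChainEvent j hB)]
  exact gibbs_chainEvent_le u₀ h ha hθ hK Φ hj hB

/-- **Registered prelim (1/2) of `stub_tightChainPressure`**: the fixed-time chain bound under `G_N` in
closed form — for `SmallDensity uniformProfile σ`, `a, θ > 0`, `K ≤ N`, every flow `Φ`, time `t`, injective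
label sequence `j` and measurable link sets `B`,
`G_N{∀ m, x_{j(m+1)}(t) − x_{j m}(t) ∈ B m} ≤ 2^{K+1} ∏_m vol(B m)`. -/
theorem gibbs_chainEventAt_bound : ∀ (σ a θ : ℝ) (u₀ : V3), SmallDensity uniformProfile σ → 0 < a → 0 < θ → ∀ (N K : ℕ), K ≤ N → ∀ (Φ : Flow σ N) (t : ℝ) (j : Fin (K + 1) → Fin (N + 1)), Function.Injective j → ∀ (B : Fin K → Set T3), (∀ m, MeasurableSet (B m)) → gibbs σ a θ u₀ N Φ {z : Phase N | ∀ m : Fin K, (Φ.flow t z (j m.succ)).1 - (Φ.flow t z (j m.castSucc)).1 ∈ B m} ≤ 2 ^ (K + 1) * ∏ m, volume (B m) :=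
  fun _σ _a _θ u₀ h ha hθ _N _K hK Φ t _j hj _B hB => gibbs_chainEventAt_le u₀ h ha hθ hK Φ t hj hB

end

end Summit.AtomisticToContinuum.HydrodynamicLimit.Theorems.TrueAnchoredInfection
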